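import Summits.ResolutionOfSingularities.ResolutionOfSingularities.Theorems.FrobeniusClosingSteerBetaPreparedTransferY
import Summits.ResolutionOfSingularities.ResolutionOfSingularities.Theorems.FrobeniusClosingSteerBetaHatLawWords
import HarnessLib

/-!
# Crux `Steer` (stmt-ResolutionOfSingularities-16345), chain W4.1, β-LEAF, K-β2♭ part (II-Y): the tree word
# `BetaHat.PreparedTransferYHat` HOLDS (def-free)

OURS (campaign `res-hironaka`, rung L ★L-G4, slot W4.1; statements about the route's own objects; they replace the
role of no printed item and are NOT statements of the manuscript under review [claim: Hironaka2017, status: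
under-review]; AI review is weaker than expert review). Seat res-D-pv-003 (gen 7), K-β2♭ kernel owner (res-L0-w41-plan-1
RULINGS 143/150 (2)/181b/185d).

`preparedTransferYHat_holds : PreparedTransferYHat` — the β-leaf binder `hIIy` (word of record: res-D-pv-035's
`…BetaHatLawWords` p553853, = res-L0-w41-idea-1 v18.4-J4 §5 with the square-free twist clause R-J4a in `BetaPolygon.IsArithStage`,
`…BetaHatStageWords` p552756) is a λ-wrapper over `BetaNewton.preparedTransferY` (`…BetaPreparedTransferY` p553446): destructure
`IsHatRing` (regular, dimension four, perfect residue field; completeness unused), `IsArithStage` (span, square-free twist — only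
`b ≤ 1` is used —, cone clause), `IsYChartHat` (surjectivity of `κ → κ₁`, the substitution equalities) and `IsPreparedTwAt`, and
repackage the conclusion, which is the body of `IsPreparedTwAt u₁ x₁ (φ y) z₁ w₁ d α (α + β − 1) f₁` verbatim.

[cite: CossartJannsenSaito2020, Lemma 12.2] No Theses file is imported; nothing here is a route item or a registration.
-/

noncomputable section

-- `Summit.<S>.<S>.…` duplicates the summit name by design (single-problem summit).
set_option linter.dupNamespace false

namespace Summit.ResolutionOfSingularities.ResolutionOfSingularities.Theorems.SwitchingDichotomy.BetaHat

open Summit.ResolutionOfSingularities.ResolutionOfSingularities.Theorems.SwitchingDichotomy.BetaPolygon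
open Summit.ResolutionOfSingularities.ResolutionOfSingularities.Theorems.SwitchingDichotomy.BetaNewton

/-- **K-β2♭ (II-Y) holds**: `PreparedTransferYHat` (β-leaf of record v18.4-J4, square-free twist) — CJS Lemma 12.2 (4) modulo
`u`-squares along the `y`-chart letter — by `BetaNewton.preparedTransferY`. [cite: CossartJannsenSaito2020, Lemma 12.2] -/
theorem preparedTransferYHat_holds : PreparedTransferYHat := by
  intro S S₁ _ _ _ _ _ _ φ σ σ₁ x y z w u f x₁ z₁ w₁ u₁ f₁ d k α β hS hS₁ _ h3 hA hY hrad hA₁ hprep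
  obtain ⟨-, hreg, -, hdim, hperf⟩ := hS
  obtain ⟨-, hreg₁, -, hdim₁, -⟩ := hS₁
  obtain ⟨hspan, ⟨a, b, -, hb, hu⟩, hcone⟩ := hA
  obtain ⟨-, ⟨a₁, b₁, -, -, hu₁⟩, hcone₁⟩ := hA₁
  obtain ⟨-, -, -, hsurj, hspan₁, hx, hz, hw⟩ := hY
  obtain ⟨hα, hβ, hAl, hG, -, hnd⟩ := hprep
  exact preparedTransferY hreg hdim hperf hreg₁ hdim₁ φ σ hsurj (by omega) hspan hu hb hcone hspan₁ hu₁ hcone₁ hx hz hw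
    hrad hα hβ hAl hG (fun q h => hnd (Or.inl ⟨q, h⟩)) (fun a b hab c₁ c₂ q h => hnd (Or.inr ⟨a, b, hab, c₁, c₂, q, h⟩))

end Summit.ResolutionOfSingularities.ResolutionOfSingularities.Theorems.SwitchingDichotomy.BetaHat

end
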